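import Literature.AlgebraicGeometry.ShimuraVarieties.RapoportSmithlingZhang2020.AppBLocalModelsBanalSignature
import Mathlib.LinearAlgebra.Eigenspace.Minpoly
import HarnessLib

/-!
# [RapoportSmithlingZhang2020Diagonal, App. B Lemma B.3 (arXiv v6 p. 60)] «Suppose that `L/K` is unramified. Then the Kottwitz
# condition (B.2) on `P_Λ` implies the Eisenstein condition (B.5)» — DISCHARGED: `RSZ2020_B_3_holds`

Kernel-lane companion of the statement carpet ★
`Literature/AlgebraicGeometry/ShimuraVarieties/RapoportSmithlingZhang2020/AppBLocalModelsBanalSignature.lean`: its named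
fact ★ `RSZ2020_B_3` — M. Rapoport, B. Smithling, W. Zhang, *Arithmetic diagonal cycles on unitary Shimura varieties*,
Compositio Math. 156 (2020), Appendix B «Local models in the case of banal signature», Lemma B.3 (arXiv 1710.06962v6 p. 60),
in the carpet's unramified reading (`κ = ι`, `res = id`, banal `r`, the (B.3) idempotents `e_ψ`, embeddings separated by a
unit, `R ≠ 0`) — is PROVED here.  THEOREMS ONLY (no definition, no named fact, no `sorry`, no instance, no notation); cell
hodgecm-mathlib, seat B-typ04 (g31); net debt −1.

## The proof (as printed, p. 60)

«When `L = L^t` is unramified over `K`, then all sets `A_ψ` have at most one element. If `A_ψ` is empty, then `(P_Λ)_ψ = 0`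
and the condition (B.5) is empty. If `A_ψ` is non-empty, then the condition (B.5) is equivalent to the definition of the
`ψ`-eigenspace in the decomposition (B.4).»

* `act_apply_of_mem_component` — on `(P_Λ)_ψ = e_ψ · P_Λ`, `a ⊗ 1` acts by the scalar `ψ(a)` (the defining property (B.3) of
  the idempotents).  Hence (`Module.End.aeval_apply_of_mem_apply_eq_smul`) every polynomial `Q(a ⊗ 1)` acts on `(P_Λ)_ψ` by
  `Q(ψ(a))`.
* `A_ψ` non-empty (`r_ψ = n`): `A_ψ = {ψ}`, `Q_{A_ψ} = T − ψ(π)`, and `Q_{A_ψ}(π ⊗ 1) = 0` on `(P_Λ)_ψ` is the eigenspace identity.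
* `A_ψ` empty (`r_ψ = 0`): «`(P_Λ)_ψ = 0`» — by Cayley–Hamilton for the Kottwitz polynomial (B.2) at the separating element
  `a`, `∏_φ (ψ(a) − φ(a))^{r_φ}` kills `(P_Λ)_ψ`; the factor `φ = ψ` has exponent `r_ψ = 0` and the others are units, so
  `(P_Λ)_ψ = 0` and (B.5) (`Q_{A_ψ} = 1`) holds trivially.

## References
* [RapoportSmithlingZhang2020Diagonal] M. Rapoport, B. Smithling, W. Zhang, *Arithmetic diagonal cycles on unitary Shimura
  varieties*, Compos. Math. 156 (2020) 1745–1824; arXiv:1710.06962v6, App. B Lemma B.3 (p. 60), (B.2)–(B.5) (p. 59).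
-/

set_option autoImplicit false

noncomputable section

open scoped TensorProduct
open Polynomial

namespace Literature.AlgebraicGeometry.ShimuraVarieties.RapoportSmithlingZhang2020.AppBLocalModelsBanalSignature

universe u

section Component

variable {OK OL R : Type u} [CommRing OK] [CommRing OL] [Algebra OK OL] [CommRing R] [Algebra OK R]
variable {P : Type u} [AddCommGroup P] [Module (R ⊗[OK] OL) P] [Module R P] [IsScalarTower R (R ⊗[OK] OL) P]

/-- (B.3)/(B.4): on the `ψ`-component `(P_Λ)_ψ = e_ψ · P_Λ`, the endomorphism `a ⊗ 1` is the scalar `ψ(a) ∈ O_S`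
(«the definition of the `ψ`-eigenspace in the decomposition (B.4)»). [cite: RapoportSmithlingZhang2020Diagonal, App. B (B.3)–(B.4) p. 59] -/
private theorem act_apply_of_mem_component {ι : Type u} [Fintype ι] {θ : ι → (OL →+* R)} {e : ι → R ⊗[OK] OL}
    (he : IsDecompositionB3 θ e) (ψ : ι) (a : OL) {y : P} (hy : y ∈ component P e ψ) :
    act P ((1 : R) ⊗ₜ[OK] a) y = θ ψ a • y := by
  obtain ⟨z, rfl⟩ := LinearMap.mem_range.mp hy
  show ((1 : R) ⊗ₜ[OK] a) • (e ψ • z) = θ ψ a • (e ψ • z)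
  rw [← mul_smul, he.2.2.2 ψ a, mul_smul, algebraMap_smul]

end Component

/-- ★ `RSZ2020_B_3` HOLDS. [RapoportSmithlingZhang2020Diagonal, App. B Lemma B.3 (arXiv v6 p. 60)]: «Suppose that `L/K` is
unramified. Then the Kottwitz condition (B.2) on `P_Λ` implies the Eisenstein condition (B.5).» — in the carpet's reading
(`κ = ι`, `res = id`, banal `r`, (B.3) idempotents, embeddings separated by a unit).  Proof as printed: `A_ψ` has at most one
element; `A_ψ = {ψ}` gives the eigenspace identity, `A_ψ = ∅` gives `(P_Λ)_ψ = 0` (here: Cayley–Hamilton for the Kottwitz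
polynomial at the separating element). [cite: RapoportSmithlingZhang2020Diagonal, App. B Lemma B.3 p. 60] -/
theorem RSZ2020_B_3_holds : RSZ2020_B_3.{u} := by
  intro OK OL R _ _ _ _ _ _ ι _ n r θ π e P _ _ _ _ _ _ q _ hn hban he hsep hK ψ x hx
  classical
  -- every polynomial in `π ⊗ 1` acts on the `ψ`-component by its value at `ψ(π)`
  have hxπ : act P ((1 : R) ⊗ₜ[OK] π) x = θ ψ π • x := act_apply_of_mem_component he ψ π hx
  rw [Module.End.aeval_apply_of_mem_apply_eq_smul hxπ]
  rcases hban ψ with h0 | hnψ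
  · -- `A_ψ = ∅`: the component vanishes
    obtain ⟨a, ha⟩ := hsep
    have hxa : act P ((1 : R) ⊗ₜ[OK] a) x = θ ψ a • x := act_apply_of_mem_component he ψ a hx
    -- Cayley–Hamilton for the Kottwitz polynomial of `a ⊗ 1`
    have hCH := LinearMap.aeval_self_charpoly (act P ((1 : R) ⊗ₜ[OK] a))
    rw [hK a] at hCH
    have hzero : (∏ φ, (X - C (θ φ a)) ^ r φ).eval (θ ψ a) • x = 0 := by
      rw [← Module.End.aeval_apply_of_mem_apply_eq_smul hxa, hCH, LinearMap.zero_apply]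
    simp only [eval_prod, eval_pow, eval_sub, eval_X, eval_C] at hzero
    have hunit : IsUnit (∏ φ, (θ ψ a - θ φ a) ^ r φ) := by
      refine Finset.prod_induction _ IsUnit (fun _ _ hu hv => hu.mul hv) isUnit_one fun φ _ => ?_
      by_cases hφ : φ = ψ
      · subst hφ
        rw [h0, pow_zero]
        exact isUnit_one
      · exact (ha ψ φ (Ne.symm hφ)).pow _
    have hx0 : x = 0 := (hunit.smul_eq_zero).mp hzero
    rw [hx0, smul_zero]
  · -- `A_ψ = {ψ}`: the eigenspace identity
    have hA : ASet n r id ψ = {ψ} := by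
      ext φ
      simp only [ASet, Set.mem_setOf_eq, id, Set.mem_singleton_iff]
      exact ⟨fun h => h.1, fun h => ⟨h, h ▸ hnψ⟩⟩
    rw [hA, QPoly, finprod_mem_singleton]
    simp

end Literature.AlgebraicGeometry.ShimuraVarieties.RapoportSmithlingZhang2020.AppBLocalModelsBanalSignature
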